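import Mathlib.Analysis.InnerProductSpace.PiL2
import Mathlib.Analysis.InnerProductSpace.Orthonormal
import Literature.Computability.QuantumComplexity.GaussianRank

/-!
# `SymplecticPurity.GaussianDegreeBound` (stmt-QuantumAdvantage-9838) — II: Gaussian action and Bessel

Helper file (prover, `--supports stmt-QuantumAdvantage-9838`) for the support item
`GaussianDegreeBound` of route SymplecticPurity.  Two independent ingredients:

* GAUSSIAN ACTION ON WORDS.  From `U c_p U† = Σ_q R_{pq} c_q` with `R Rᵀ = 1` (so `Rᵀ R = 1`):
  `U† c_q U = Σ_p R_{pq} c_p` (`star_mul_majorana_mul`), hence conjugation by `U†` maps every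
  Majorana WORD `c_{q₁} ⋯ c_{q_m}` into the span of the words of the same length
  (`star_mul_word_mul_mem_span`) — no normal ordering, compound matrices or determinants are needed
  for the purity bound, only this filtration.
* BESSEL FOR A FUNCTIONAL.  In a complex inner product space, if `(u_i)` and `(b_k)` are finite
  orthogonal families with the same square norm `N > 0` and every `u_i` lies in the span of the
  `b_k`, then `Σ_i |f(u_i)|² ≤ Σ_k |f(b_k)|²` for every linear functional `f`
  (`sum_norm_sq_le_of_mem_span`: Riesz representer of `f` on the span + Bessel's inequality).
* The Hilbert–Schmidt pairing of matrices read through ANY coordinate map `Φ` into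
  `EuclideanSpace ℂ (m × m)` (`inner_eq_trace_of_apply`), and the two orthogonality relations it
  is applied to: Pauli strings, and Pauli strings conjugated by a unitary (both `2ⁿ δ`).
-/

set_option linter.dupNamespace false -- D-0017: single-problem summit ⇒ `QuantumAdvantage.QuantumAdvantage` by design

noncomputable section

namespace Summit.QuantumAdvantage.QuantumAdvantage.Theorems.SymplecticPurity

open Matrix Finset
open scoped InnerProductSpace
open Literature.Computability.QuantumComplexity Literature.Computability.Cryptography

/-! ### The Gaussian action on Majoranas and on words -/

variable {n : ℕ}

/-- Conjugating back through a unitary: `U† (U M U†) U = M`. -/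
theorem star_mul_conj_mul_eq {U : Matrix (QReg n) (QReg n) ℂ}
    (hU : U ∈ Matrix.unitaryGroup (QReg n) ℂ) (M : Matrix (QReg n) (QReg n) ℂ) :
    star U * (U * M * star U) * U = M := by
  have h1 : star U * U = 1 := Unitary.star_mul_self_of_mem hU
  calc star U * (U * M * star U) * U = (star U * U) * M * (star U * U) := by
        simp only [Matrix.mul_assoc]
    _ = M := by rw [h1, Matrix.one_mul, Matrix.mul_one]

/-- **The inverse rotation**: if `U c_p U† = Σ_q R_{pq} c_q` for all `p` with `R Rᵀ = 1`, then
`U† c_q U = Σ_p R_{pq} c_p` for all `q` (`Rᵀ R = 1` for a square matrix). -/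
theorem star_mul_majorana_mul {U : Matrix (QReg n) (QReg n) ℂ}
    (hU : U ∈ Matrix.unitaryGroup (QReg n) ℂ) {R : Matrix (Fin n × Bool) (Fin n × Bool) ℝ}
    (hR : R * Rᵀ = 1)
    (hG : ∀ p : Fin n × Bool, U * majorana n p.1 p.2 * star U =
      ∑ q : Fin n × Bool, (R p q : ℂ) • majorana n q.1 q.2)
    (q : Fin n × Bool) :
    star U * majorana n q.1 q.2 * U = ∑ p : Fin n × Bool, (R p q : ℂ) • majorana n p.1 p.2 := by
  have hRt : Rᵀ * R = 1 := mul_eq_one_comm.1 hR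
  have hsum : ∀ q' : Fin n × Bool,
      ∑ p, (R p q : ℂ) * (R p q' : ℂ) = if q = q' then 1 else 0 := by
    intro q'
    have h := congrFun (congrFun hRt q) q'
    simp only [Matrix.mul_apply, Matrix.transpose_apply, Matrix.one_apply] at h
    by_cases hqq : q = q'
    · rw [if_pos hqq] at h ⊢
      exact_mod_cast h
    · rw [if_neg hqq] at h ⊢
      exact_mod_cast h
  have key : U * (∑ p : Fin n × Bool, (R p q : ℂ) • majorana n p.1 p.2) * star U =
      majorana n q.1 q.2 := by
    rw [Finset.mul_sum, Finset.sum_mul]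
    simp_rw [Matrix.mul_smul, Matrix.smul_mul, hG, Finset.smul_sum, smul_smul]
    rw [Finset.sum_comm]
    simp_rw [← Finset.sum_smul, hsum, ite_smul, one_smul, zero_smul, Finset.sum_ite_eq,
      Finset.mem_univ, if_true]
  calc star U * majorana n q.1 q.2 * U
      = star U * (U * (∑ p : Fin n × Bool, (R p q : ℂ) • majorana n p.1 p.2) * star U) * U := by
        rw [key]
    _ = _ := star_mul_conj_mul_eq hU _

/-- **The Gaussian action on words**: if `U† c_q U = Σ_p R_{pq} c_p` for all `q`, then for every
word `w = [q₁, …, q_m]`, `U† (c_{q₁} ⋯ c_{q_m}) U` lies in the span of the words of length `m`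
(insert `U U† = 1` between the letters and expand). -/
theorem star_mul_word_mul_mem_span {U : Matrix (QReg n) (QReg n) ℂ}
    (hU : U ∈ Matrix.unitaryGroup (QReg n) ℂ) {R : Matrix (Fin n × Bool) (Fin n × Bool) ℝ}
    (hq : ∀ q : Fin n × Bool, star U * majorana n q.1 q.2 * U =
      ∑ p : Fin n × Bool, (R p q : ℂ) • majorana n p.1 p.2) :
    ∀ w : List (Fin n × Bool), star U * (w.map fun q => majorana n q.1 q.2).prod * U ∈
      Submodule.span ℂ {M : Matrix (QReg n) (QReg n) ℂ | ∃ w' : List (Fin n × Bool),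
        w'.length = w.length ∧ (w'.map fun q => majorana n q.1 q.2).prod = M}
  | [] => by
    rw [List.map_nil, List.prod_nil, Matrix.mul_one, Unitary.star_mul_self_of_mem hU]
    exact Submodule.subset_span ⟨[], rfl, by rw [List.map_nil, List.prod_nil]⟩
  | q :: w => by
    have ih := star_mul_word_mul_mem_span hU hq w
    have hUU : U * star U = 1 := Matrix.mem_unitaryGroup_iff.1 hU
    rw [List.map_cons, List.prod_cons]
    have hins : star U * (majorana n q.1 q.2 * (w.map fun q => majorana n q.1 q.2).prod) * U =
        (star U * majorana n q.1 q.2 * U) *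
          (star U * (w.map fun q => majorana n q.1 q.2).prod * U) := by
      symm
      calc (star U * majorana n q.1 q.2 * U) * (star U * (w.map fun q => majorana n q.1 q.2).prod * U)
          = star U * majorana n q.1 q.2 * (U * star U) *
              (w.map fun q => majorana n q.1 q.2).prod * U := by
            simp only [Matrix.mul_assoc]
        _ = _ := by
            rw [hUU, Matrix.mul_one]
            simp only [Matrix.mul_assoc]
    rw [hins, hq q, Finset.sum_mul]
    refine Submodule.sum_mem _ fun p _ => ?_
    rw [Matrix.smul_mul]
    refine Submodule.smul_mem _ _ ?_
    refine Submodule.span_induction (p := fun x _ => majorana n p.1 p.2 * x ∈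
        Submodule.span ℂ {M : Matrix (QReg n) (QReg n) ℂ | ∃ w' : List (Fin n × Bool),
          w'.length = (q :: w).length ∧ (w'.map fun q => majorana n q.1 q.2).prod = M})
      ?_ ?_ ?_ ?_ ih
    · rintro x ⟨w', hw', rfl⟩
      refine Submodule.subset_span ⟨p :: w', by rw [List.length_cons, List.length_cons, hw'], ?_⟩
      rw [List.map_cons, List.prod_cons]
    · rw [Matrix.mul_zero]
      exact Submodule.zero_mem _
    · intro x y _ _ hx hy
      rw [Matrix.mul_add]
      exact Submodule.add_mem _ hx hy
    · intro a x _ hx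
      rw [Matrix.mul_smul]
      exact Submodule.smul_mem _ _ hx

/-! ### Bessel for a functional on the span of an orthogonal family -/

/-- Normalising an orthogonal family of common square norm `N`: `c • v` is orthonormal when
`c² N = 1` (`c` real). -/
theorem orthonormal_smul_of_inner_eq {E : Type*} [NormedAddCommGroup E] [InnerProductSpace ℂ E]
    {α : Type*} [DecidableEq α] {N : ℝ} {c : ℝ} (v : α → E)
    (hv : ∀ i j, ⟪v i, v j⟫_ℂ = if i = j then (N : ℂ) else 0)
    (hcc : (c : ℂ) * (c : ℂ) * (N : ℂ) = 1) : Orthonormal ℂ (fun i => (c : ℂ) • v i) := by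
  rw [orthonormal_iff_ite]
  intro i j
  rw [inner_smul_left, inner_smul_right, hv, Complex.conj_ofReal]
  split_ifs
  · rw [← mul_assoc, hcc]
  · rw [mul_zero, mul_zero]

/-- **Bessel for a linear functional.** In a complex inner product space let `(u_i)_i` and
`(b_k)_k` be finite families with `⟪u_i, u_j⟫ = N δ_{ij}`, `⟪b_k, b_l⟫ = N δ_{kl}` (`N > 0`) and
every `u_i` in the span of the `b_k`.  Then `Σ_i |f(u_i)|² ≤ Σ_k |f(b_k)|²` for every linear
functional `f`.  (Normalise; `r = Σ_k conj(f b_k) b_k` represents `f` on the span; Bessel's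
inequality for the orthonormal `u` gives `Σ |⟪u_i, r⟫|² ≤ ‖r‖² = Σ |f b_k|²`.) -/
theorem sum_norm_sq_le_of_mem_span {E : Type*} [NormedAddCommGroup E] [InnerProductSpace ℂ E]
    {ι κ : Type*} [Fintype ι] [Fintype κ] [DecidableEq ι] [DecidableEq κ]
    {N : ℝ} (hN : 0 < N) (u : ι → E) (b : κ → E)
    (hu : ∀ i j, ⟪u i, u j⟫_ℂ = if i = j then (N : ℂ) else 0)
    (hb : ∀ k l, ⟪b k, b l⟫_ℂ = if k = l then (N : ℂ) else 0)
    (hmem : ∀ i, u i ∈ Submodule.span ℂ (Set.range b)) (f : E →ₗ[ℂ] ℂ) :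
    ∑ i, ‖f (u i)‖ ^ 2 ≤ ∑ k, ‖f (b k)‖ ^ 2 := by
  -- normalisation
  set c : ℝ := (Real.sqrt N)⁻¹ with hc
  have hsq : Real.sqrt N * Real.sqrt N = N := Real.mul_self_sqrt hN.le
  have hc0 : 0 < c := inv_pos.2 (Real.sqrt_pos.2 hN)
  have hcc : (c : ℂ) * (c : ℂ) * (N : ℂ) = 1 := by
    have hs0 : Real.sqrt N ≠ 0 := (Real.sqrt_pos.2 hN).ne'
    have : c * c * N = 1 := by
      calc c * c * N = c * c * (Real.sqrt N * Real.sqrt N) := by rw [hsq]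
        _ = (c * Real.sqrt N) * (c * Real.sqrt N) := by ring
        _ = 1 := by rw [hc, inv_mul_cancel₀ hs0, one_mul]
    exact_mod_cast this
  have hcne : (c : ℂ) ≠ 0 := by exact_mod_cast hc0.ne'
  have hu' : Orthonormal ℂ (fun i => (c : ℂ) • u i) := orthonormal_smul_of_inner_eq u hu hcc
  have hb' : Orthonormal ℂ (fun k => (c : ℂ) • b k) := orthonormal_smul_of_inner_eq b hb hcc
  -- the Riesz representer of `f` on the span of the `b' k = c • b k`
  set r : E := ∑ k, (starRingEnd ℂ) (f ((c : ℂ) • b k)) • ((c : ℂ) • b k) with hr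
  have hrep : ∀ v ∈ Submodule.span ℂ (Set.range fun k => (c : ℂ) • b k), f v = ⟪r, v⟫_ℂ := by
    intro v hv
    induction hv using Submodule.span_induction with
    | mem x hx =>
      obtain ⟨k, rfl⟩ := hx
      rw [hr, hb'.inner_left_fintype, RingHomCompTriple.comp_apply, RingHom.id_apply]
    | zero => rw [map_zero, inner_zero_right]
    | add x y _ _ hx hy => rw [map_add, inner_add_right, hx, hy]
    | smul a x _ hx => rw [map_smul, inner_smul_right, hx, smul_eq_mul]
  have hspan : Submodule.span ℂ (Set.range b) ≤ Submodule.span ℂ (Set.range fun k => (c : ℂ) • b k) := by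
    rw [Submodule.span_le]
    rintro _ ⟨k, rfl⟩
    have : b k = (c : ℂ)⁻¹ • ((c : ℂ) • b k) := by
      rw [smul_smul, inv_mul_cancel₀ hcne, one_smul]
    rw [this]
    exact Submodule.smul_mem _ _ (Submodule.subset_span ⟨k, rfl⟩)
  have hmem' : ∀ i, (c : ℂ) • u i ∈ Submodule.span ℂ (Set.range fun k => (c : ℂ) • b k) :=
    fun i => Submodule.smul_mem _ _ (hspan (hmem i))
  have hrmem : r ∈ Submodule.span ℂ (Set.range fun k => (c : ℂ) • b k) :=
    Submodule.sum_mem _ fun k _ => Submodule.smul_mem _ _ (Submodule.subset_span ⟨k, rfl⟩)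
  -- Bessel
  have h1 : ∑ i, ‖f ((c : ℂ) • u i)‖ ^ 2 ≤ ‖r‖ ^ 2 := by
    calc ∑ i, ‖f ((c : ℂ) • u i)‖ ^ 2 = ∑ i, ‖⟪(c : ℂ) • u i, r⟫_ℂ‖ ^ 2 := by
          refine Finset.sum_congr rfl fun i _ => ?_
          rw [hrep _ (hmem' i), norm_inner_symm]
      _ ≤ ‖r‖ ^ 2 := hu'.sum_inner_products_le r
  -- `‖r‖² = Σ |f b'_k|²`
  have h2 : ‖r‖ ^ 2 = ∑ k, ‖f ((c : ℂ) • b k)‖ ^ 2 := by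
    have hfr : f r = ∑ k, (starRingEnd ℂ) (f ((c : ℂ) • b k)) * f ((c : ℂ) • b k) := by
      rw [hr, map_sum]
      simp only [map_smul, smul_eq_mul]
    rw [← inner_self_eq_norm_sq (𝕜 := ℂ), ← hrep r hrmem, hfr, map_sum]
    refine Finset.sum_congr rfl fun k _ => ?_
    rw [Complex.conj_mul', RCLike.re_to_complex]
    norm_cast
  -- undo the normalisation
  have hscale : ∀ x : E, ‖f ((c : ℂ) • x)‖ ^ 2 = c ^ 2 * ‖f x‖ ^ 2 := by
    intro x
    rw [map_smul, smul_eq_mul, norm_mul, Complex.norm_real, Real.norm_of_nonneg hc0.le, mul_pow]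
  simp only [hscale, ← Finset.mul_sum] at h1 h2
  rw [h2] at h1
  exact le_of_mul_le_mul_left h1 (pow_pos hc0 2)

/-! ### The Hilbert–Schmidt pairing in coordinates -/

/-- Through any coordinate identification `Φ` of `m × m` matrices with `EuclideanSpace ℂ (m × m)`,
the Euclidean inner product is the Hilbert–Schmidt pairing `⟪Φ A, Φ B⟫ = Tr(Aᴴ B)`. -/
theorem inner_eq_trace_of_apply {m : Type*} [Fintype m]
    (Φ : Matrix m m ℂ → EuclideanSpace ℂ (m × m)) (hΦ : ∀ A p, Φ A p = A p.1 p.2)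
    (A B : Matrix m m ℂ) : ⟪Φ A, Φ B⟫_ℂ = (Aᴴ * B).trace := by
  rw [EuclideanSpace.inner_eq_star_dotProduct, dotProduct, Matrix.trace]
  simp only [Pi.star_apply, Matrix.diag_apply, Matrix.mul_apply, Matrix.conjTranspose_apply]
  rw [Fintype.sum_prod_type, Finset.sum_comm]
  refine Finset.sum_congr rfl fun y _ => Finset.sum_congr rfl fun x _ => ?_
  rw [show (Φ B).ofLp (x, y) = Φ B (x, y) from rfl, show (Φ A).ofLp (x, y) = Φ A (x, y) from rfl,
    hΦ, hΦ, mul_comm]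

/-- Hilbert–Schmidt orthogonality of the Pauli strings in coordinates: `⟪σ_S, σ_T⟫ = 2ⁿ δ_{ST}`. -/
theorem inner_pauliString (Φ : Matrix (QReg n) (QReg n) ℂ → EuclideanSpace ℂ (QReg n × QReg n))
    (hΦ : ∀ A p, Φ A p = A p.1 p.2) (S T : Fin n → Pauli) :
    ⟪Φ (pauliString S), Φ (pauliString T)⟫_ℂ = if S = T then (2 : ℂ) ^ n else 0 := by
  rw [inner_eq_trace_of_apply Φ hΦ, conjTranspose_pauliString, trace_pauliString_mul_pauliString,
    Fintype.card_fin]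

/-- Conjugation by a unitary preserves Hilbert–Schmidt orthogonality of the Pauli strings:
`⟪U† σ_S U, U† σ_T U⟫ = 2ⁿ δ_{ST}`. -/
theorem inner_conj_pauliString {U : Matrix (QReg n) (QReg n) ℂ}
    (hU : U ∈ Matrix.unitaryGroup (QReg n) ℂ)
    (Φ : Matrix (QReg n) (QReg n) ℂ → EuclideanSpace ℂ (QReg n × QReg n))
    (hΦ : ∀ A p, Φ A p = A p.1 p.2) (S T : Fin n → Pauli) :
    ⟪Φ (star U * pauliString S * U), Φ (star U * pauliString T * U)⟫_ℂ =
      if S = T then (2 : ℂ) ^ n else 0 := by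
  have hUU : U * star U = 1 := Matrix.mem_unitaryGroup_iff.1 hU
  rw [inner_eq_trace_of_apply Φ hΦ]
  have h1 : (star U * pauliString S * U)ᴴ = star U * pauliString S * U := by
    rw [Matrix.conjTranspose_mul, Matrix.conjTranspose_mul, conjTranspose_pauliString,
      ← Matrix.star_eq_conjTranspose, ← Matrix.star_eq_conjTranspose, star_star, Matrix.mul_assoc]
  rw [h1]
  have h2 : star U * pauliString S * U * (star U * pauliString T * U) =
      star U * (pauliString S * pauliString T) * U := by
    calc star U * pauliString S * U * (star U * pauliString T * U)
        = star U * pauliString S * (U * star U) * pauliString T * U := by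
          simp only [Matrix.mul_assoc]
      _ = _ := by rw [hUU, Matrix.mul_one, Matrix.mul_assoc (star U)]
  rw [h2, Matrix.trace_mul_cycle, ← Matrix.mul_assoc, hUU, Matrix.one_mul,
    trace_pauliString_mul_pauliString, Fintype.card_fin]

end Summit.QuantumAdvantage.QuantumAdvantage.Theorems.SymplecticPurity

end
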